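import Summits.Schanuel.Schanuel.Theorems.ZilberEacSuperellipticGraphFibres
import HarnessLib

/-!
# Arbitrary base branches, XXXIV: the OTHER SHEETS — for `k ≥ 3` every cyclic cover
# `x₁^k = P(x₀)` has a sheet at infinity with a good direction: no residue class, no circle

HONEST FRAMING.  Cell `pub-schanuel` (Zilber's Exponential-Algebraic Closedness, case ladder;
host summit Schanuel), seat 2, gen 29.  Files XX–XXII, XXX, XXXIII parametrised `C : x₁^k = P(x₀)`
at infinity by the PRINCIPAL sheet `x₁ = U₀(s)^{1/k}s^{-M}` (`Φ(0) = 1`) and met the residue class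
`k ∣ 2M ∧ 2M/k ≡ 2 (mod 4)`, where `z^M ∈ iℝ` for every `k`-th root `z` of `2πi`.  But over each
large `x₀` the curve has `k` points `x₁ = ζ·P(x₀)^{1/k}`, `ζ ∈ μ_k`, ALL of which lie on the
cylinder `S = C × {fibre}`: the sheet `Φ_ζ = ζ·U₀^{1/k}` has direction `Φ_ζ(0) = ζ`, and
`Re(ζ z^M) ≠ 0` as soon as `ζ ∉ ℝ` when `z^M ∈ iℝ` — available iff `k ≥ 3`
(**`exists_sheet_direction`**).  Hence, with NO residue and NO circle condition, for every `k ≥ 3`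
and every monic `P` of degree `M ≥ 1` with a simple root:
**`unprojectedDensityQuestion_superelliptic_constFibre_all`** (`y₀ = θ`, every `θ ≠ 0`),
**`unprojectedDensityQuestion_superelliptic_fibre_x₁_all`**, **`…_fibre_x₀_all`** (the coordinate
fibres, file XXXII's pole route) — case ∧ DENSE; e.g. **`{x₁³ = x₀³ + 1, y₀ = θ}`** (the
`(3,3)`-type curve the cell's notes H201 (γ) had marked open on the principal sheet).  What the
sheets do NOT reach: `k = 2` (both sheets `±1` are real): the hyperelliptic curves of degree
`M ≡ 2 (mod 4)`, where file XXX's circle (constant fibres) and the logarithmic term (pole fibres,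
next) are the content.  Decided instances of an OPEN question (Mantova–Masser, PLMS 2024 §1 p. 5);
EC(3,2) OPEN; NOT Schanuel's conjecture (neither used nor implied); EAC ⇏ SC.
-/

noncomputable section

open Filter Topology Set Complex MvPolynomial
open Literature.NumberTheory.Transcendental Literature.ModelTheory.Zilber
open Literature.ModelTheory.ExponentialFields

set_option linter.dupNamespace false

namespace Summit.Schanuel.Schanuel.Theorems

/-! ## Part A. A sheet with a good direction (`k ≥ 3`) -/

/-- **A good sheet.**  For `k ≥ 3` and any `M` there are `ζ ∈ μ_k` and a `k`-th root `z` of `2πi`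
with `Re(ζ·z^M) ≠ 0`: if `Re z^M ≠ 0` take `ζ = 1`, else `z^M ∈ iℝ ∖ 0` and `ζ = e^{2πi/k}` has
`Im ζ = sin(2π/k) > 0`. [folklore] -/
theorem exists_sheet_direction {k : ℕ} (hk : 3 ≤ k) (M : ℕ) :
    ∃ ζ z : ℂ, ζ ^ k = 1 ∧ z ^ k = 2 * Real.pi * I ∧ (ζ * z ^ M).re ≠ 0 := by
  have hk0 : k ≠ 0 := by omega
  have h2πI : (2 * Real.pi * I : ℂ) ≠ 0 := by simp [Real.pi_ne_zero, Complex.I_ne_zero]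
  obtain ⟨z, hz⟩ := IsAlgClosed.exists_pow_nat_eq (2 * Real.pi * I : ℂ) (by omega : 0 < k)
  have hz0 : z ≠ 0 := by
    rintro rfl
    rw [zero_pow hk0] at hz
    exact h2πI hz.symm
  have hw0 : z ^ M ≠ 0 := pow_ne_zero _ hz0
  by_cases hre : (z ^ M).re ≠ 0
  · exact ⟨1, z, one_pow k, hz, by rwa [one_mul]⟩
  · push Not at hre
    have him : (z ^ M).im ≠ 0 := by
      intro h
      exact hw0 (Complex.ext (by rw [hre, Complex.zero_re]) (by rw [h, Complex.zero_im]))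
    set ζ : ℂ := Complex.exp (2 * Real.pi * I / k) with hζ
    have hζk : ζ ^ k = 1 := (Complex.isPrimitiveRoot_exp k hk0).pow_eq_one
    have hζim : ζ.im = Real.sin (2 * Real.pi / k) := by
      rw [hζ, show (2 * Real.pi * I / k : ℂ) = ((2 * Real.pi / k : ℝ) : ℂ) * I by push_cast; ring,
        Complex.exp_ofReal_mul_I_im]
    have hsin : 0 < Real.sin (2 * Real.pi / k) := by
      refine Real.sin_pos_of_pos_of_lt_pi (by positivity) ?_
      rw [div_lt_iff₀ (by positivity)]
      have h3 : (3 : ℝ) ≤ k := by exact_mod_cast hk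
      nlinarith [Real.pi_pos]
    refine ⟨ζ, z, hζk, hz, ?_⟩
    rw [Complex.mul_re, hre, mul_zero, zero_sub, neg_ne_zero]
    exact mul_ne_zero (by rw [hζim]; exact hsin.ne') him

section Superelliptic

variable (P : Polynomial ℂ)

/-- The sheet `x₀ = s^{-k}`, `x₁ = ζ·(U₀(s))^{1/k}s^{-M}` of `x₁^k = P(x₀)` at infinity (`ζ^k = 1`,
`P` monic, `k ≥ 1`): an analytic `Φ` with `Φ(0) = ζ` and `(Φ(s)s^{-M})^k = P(s^{-k})` for small
`s ≠ 0`. [folklore] -/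
theorem superelliptic_sheet_facts {k : ℕ} (hk : 1 ≤ k) (hP : P.Monic) {ζ : ℂ} (hζ : ζ ^ k = 1) :
    ∃ Φ : ℂ → ℂ, AnalyticAt ℂ Φ 0 ∧ Φ 0 = ζ ∧
      ∀ᶠ s in 𝓝[≠] (0 : ℂ), (Φ s * (s ^ P.natDegree)⁻¹) ^ k - P.eval (s ^ k)⁻¹ = 0 := by
  set M := P.natDegree with hMdef
  obtain ⟨q, hqan, hq0, hqk⟩ := kthRoot_branch_facts hk
  obtain ⟨U₀, hUan, hU0, hUeval⟩ :=
    exists_polarForm_eval P (U := fun _ : ℂ => (1 : ℂ)) analyticAt_const hk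
  rw [one_pow, mul_one, hP.leadingCoeff] at hU0
  have hvan : AnalyticAt ℂ (fun s => U₀ s - 1) 0 := hUan.sub analyticAt_const
  have hv0 : U₀ 0 - 1 = 0 := by rw [hU0, sub_self]
  have hqk' : ∀ᶠ s in 𝓝 (0 : ℂ), q (U₀ s - 1) ^ k = 1 + (U₀ s - 1) := by
    have h := hvan.continuousAt.tendsto
    rw [hv0] at h
    exact h.eventually hqk
  refine ⟨fun s => ζ * q (U₀ s - 1), analyticAt_const.mul (hqan.comp_of_eq hvan hv0),
    by simp only [hU0, sub_self, hq0, mul_one], ?_⟩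
  filter_upwards [self_mem_nhdsWithin, nhdsWithin_le_nhds hqk'] with s (hs : s ≠ 0) hqs
  have hU := hUeval s hs
  simp only [one_mul, inv_pow] at hU
  rw [mul_pow, mul_pow, hζ, one_mul, hqs, hU, inv_pow, ← pow_mul, Nat.mul_comm M k,
    show (1 : ℂ) + (U₀ s - 1) = U₀ s by ring, sub_self]

/-! ## Part B. Constant fibres: every `θ ≠ 0`, every `k ≥ 3` -/

/-- **Constant fibres over `x₁^k = P(x₀)`, `k ≥ 3`: dense for EVERY `θ ≠ 0`** (`P` monic of
degree `M ≥ 1` with a simple root) — growth on a good sheet (file XIX).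
[cite: MantovaMasser2023, §1 Further remarks, p. 5 (the question, open in general)] (new) -/
theorem unprojectedDense_superelliptic_constFibre_all {k : ℕ} (hk : 3 ≤ k) (hP : P.Monic)
    (hM : 1 ≤ P.natDegree) {r : ℂ} (hr : P.IsRoot r) (hr1 : P.derivative.eval r ≠ 0) {θ : ℂ}
    (hθ : θ ≠ 0) :
    UnprojectedDense {w : Fin 2 ⊕ Fin 2 → ℂ |
      MvPolynomial.eval ![w (Sum.inl 0), w (Sum.inl 1)]
          (X 1 ^ k - Polynomial.aeval (X 0 : MvPolynomial (Fin 2) ℂ) P) = 0 ∧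
      w (Sum.inr 0) = MvPolynomial.eval ![w (Sum.inl 0), w (Sum.inl 1)]
        (MvPolynomial.C θ : MvPolynomial (Fin 2) ℂ)} := by
  have hk1 : 1 ≤ k := by omega
  have hS := isIrreducibleClosed_curveGraphFibre (MvPolynomial.C θ : MvPolynomial (Fin 2) ℂ)
    (irreducible_superellipticMv P hk1 hr hr1)
  have hdim := zariskiDim_curveGraphFibre (MvPolynomial.C θ : MvPolynomial (Fin 2) ℂ)
    (irreducible_superellipticMv P hk1 hr hr1)
  obtain ⟨ζ, z, hζ, hz, hre⟩ := exists_sheet_direction hk P.natDegree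
  obtain ⟨Φ, hΦan, hΦ0, hsheet⟩ := superelliptic_sheet_facts P hk1 hP hζ
  have hgerm : ∀ᶠ s in 𝓝[≠] (0 : ℂ),
      (Sum.elim ![(s ^ k)⁻¹, Φ s * (s ^ P.natDegree)⁻¹]
          ![(fun _ : ℂ => θ) s, Complex.exp (Φ s * (s ^ P.natDegree)⁻¹)] : Fin 2 ⊕ Fin 2 → ℂ) ∈
        {w : Fin 2 ⊕ Fin 2 → ℂ |
          MvPolynomial.eval ![w (Sum.inl 0), w (Sum.inl 1)]
              (X 1 ^ k - Polynomial.aeval (X 0 : MvPolynomial (Fin 2) ℂ) P) = 0 ∧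
          w (Sum.inr 0) = MvPolynomial.eval ![w (Sum.inl 0), w (Sum.inl 1)]
            (MvPolynomial.C θ : MvPolynomial (Fin 2) ℂ)} := by
    filter_upwards [hsheet] with s hs
    refine ⟨?_, ?_⟩
    · simp only [Sum.elim_inl, Matrix.cons_val_zero, Matrix.cons_val_one]
      rw [eval_superellipticMv]
      simpa only [Matrix.cons_val_zero, Matrix.cons_val_one] using hs
    · simp only [Sum.elim_inr, Matrix.cons_val_zero, MvPolynomial.eval_C]
  exact unprojectedDense_branch_growth_of_exists_direction hS (le_of_eq hdim) hk1 hM analyticAt_const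
    hθ rfl hΦan ⟨z, hz, by rw [hΦ0]; exact hre⟩ hgerm

/-- **Mantova–Masser's question for `{x₁^k − P(x₀) = 0, y₀ = θ}`, `k ≥ 3`: case ∧ dense for EVERY
`θ ≠ 0`** (`P` monic of degree `≥ 1` with a simple root), in plain coordinates.
[cite: MantovaMasser2023, §1 Further remarks, p. 5 (the question, open in general)] (new) -/
theorem unprojectedDensityQuestion_superelliptic_constFibre_all {k : ℕ} (hk : 3 ≤ k) (hP : P.Monic)
    (hM : 1 ≤ P.natDegree) {r : ℂ} (hr : P.IsRoot r) (hr1 : P.derivative.eval r ≠ 0) {θ : ℂ}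
    (hθ : θ ≠ 0) :
    MMCaseDimPiOneFree {w : Fin 2 ⊕ Fin 2 → ℂ |
        w (Sum.inl 1) ^ k - P.eval (w (Sum.inl 0)) = 0 ∧ w (Sum.inr 0) = θ} ∧
      UnprojectedDense {w : Fin 2 ⊕ Fin 2 → ℂ |
        w (Sum.inl 1) ^ k - P.eval (w (Sum.inl 0)) = 0 ∧ w (Sum.inr 0) = θ} := by
  have e : {w : Fin 2 ⊕ Fin 2 → ℂ |
        MvPolynomial.eval ![w (Sum.inl 0), w (Sum.inl 1)]
            (X 1 ^ k - Polynomial.aeval (X 0 : MvPolynomial (Fin 2) ℂ) P) = 0 ∧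
        w (Sum.inr 0) = MvPolynomial.eval ![w (Sum.inl 0), w (Sum.inl 1)]
          (MvPolynomial.C θ : MvPolynomial (Fin 2) ℂ)} =
      {w : Fin 2 ⊕ Fin 2 → ℂ |
        w (Sum.inl 1) ^ k - P.eval (w (Sum.inl 0)) = 0 ∧ w (Sum.inr 0) = θ} := by
    ext w
    simp only [Set.mem_setOf_eq, eval_superellipticMv, MvPolynomial.eval_C, Matrix.cons_val_zero,
      Matrix.cons_val_one]
  have h : MMCaseDimPiOneFree _ ∧ UnprojectedDense _ :=
    ⟨mmCase_superelliptic_constFibre P (k := k) (by omega) hr hr1 hθ,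
      unprojectedDense_superelliptic_constFibre_all P hk hP hM hr hr1 hθ⟩
  rw [e] at h
  exact h

/-! ## Part C. The coordinate fibres: every `k ≥ 3`, every degree -/

/-- **`y₀ = x₁` over `x₁^k = P(x₀)`, `k ≥ 3`: dense** (`P` monic of degree `M ≥ 1` with a simple
root) — the pole route of file XXXII on a good sheet.
[cite: MantovaMasser2023, §1 Further remarks, p. 5 (the question, open in general)] (new) -/
theorem unprojectedDense_superelliptic_fibre_x₁_all {k : ℕ} (hk : 3 ≤ k) (hP : P.Monic)
    (hM : 1 ≤ P.natDegree) {r : ℂ} (hr : P.IsRoot r) (hr1 : P.derivative.eval r ≠ 0) :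
    UnprojectedDense {w : Fin 2 ⊕ Fin 2 → ℂ |
      MvPolynomial.eval ![w (Sum.inl 0), w (Sum.inl 1)]
          (X 1 ^ k - Polynomial.aeval (X 0 : MvPolynomial (Fin 2) ℂ) P) = 0 ∧
      w (Sum.inr 0) = MvPolynomial.eval ![w (Sum.inl 0), w (Sum.inl 1)]
        (X 1 : MvPolynomial (Fin 2) ℂ)} := by
  have hk1 : 1 ≤ k := by omega
  have hS := isIrreducibleClosed_curveGraphFibre (X 1 : MvPolynomial (Fin 2) ℂ)
    (irreducible_superellipticMv P hk1 hr hr1)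
  have hdim := zariskiDim_curveGraphFibre (X 1 : MvPolynomial (Fin 2) ℂ)
    (irreducible_superellipticMv P hk1 hr hr1)
  obtain ⟨ζ, z, hζ, hz, hre⟩ := exists_sheet_direction hk P.natDegree
  obtain ⟨Φ, hΦan, hΦ0, hsheet⟩ := superelliptic_sheet_facts P hk1 hP hζ
  have hΦ0' : Φ 0 ≠ 0 := by
    rw [hΦ0]
    rintro rfl
    rw [zero_pow (by omega)] at hζ
    exact zero_ne_one hζ
  have hgerm : ∀ᶠ s in 𝓝[≠] (0 : ℂ),
      (Sum.elim ![(s ^ k)⁻¹, Φ s * (s ^ P.natDegree)⁻¹]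
          ![Φ s * s ^ (-(P.natDegree : ℤ)), Complex.exp (Φ s * (s ^ P.natDegree)⁻¹)] :
            Fin 2 ⊕ Fin 2 → ℂ) ∈
        {w : Fin 2 ⊕ Fin 2 → ℂ |
          MvPolynomial.eval ![w (Sum.inl 0), w (Sum.inl 1)]
              (X 1 ^ k - Polynomial.aeval (X 0 : MvPolynomial (Fin 2) ℂ) P) = 0 ∧
          w (Sum.inr 0) = MvPolynomial.eval ![w (Sum.inl 0), w (Sum.inl 1)]
            (X 1 : MvPolynomial (Fin 2) ℂ)} := by
    filter_upwards [hsheet] with s hs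
    refine ⟨?_, ?_⟩
    · simp only [Sum.elim_inl, Matrix.cons_val_zero, Matrix.cons_val_one]
      rw [eval_superellipticMv]
      simpa only [Matrix.cons_val_zero, Matrix.cons_val_one] using hs
    · simp only [Sum.elim_inr, Sum.elim_inl, Matrix.cons_val_zero, Matrix.cons_val_one,
        MvPolynomial.eval_X, zpow_neg, zpow_natCast]
  exact unprojectedDense_branch_poleFibre_of_exists_direction hS (le_of_eq hdim) hk1 hM
    (-(P.natDegree : ℤ)) hΦan hΦ0' hΦan ⟨z, hz, by rw [hΦ0]; exact hre⟩ hgerm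

/-- **`y₀ = x₀` over `x₁^k = P(x₀)`, `k ≥ 3`: dense** (`P` monic of degree `M ≥ 1` with a simple
root). [cite: MantovaMasser2023, §1 Further remarks, p. 5 (the question, open in general)] (new) -/
theorem unprojectedDense_superelliptic_fibre_x₀_all {k : ℕ} (hk : 3 ≤ k) (hP : P.Monic)
    (hM : 1 ≤ P.natDegree) {r : ℂ} (hr : P.IsRoot r) (hr1 : P.derivative.eval r ≠ 0) :
    UnprojectedDense {w : Fin 2 ⊕ Fin 2 → ℂ |
      MvPolynomial.eval ![w (Sum.inl 0), w (Sum.inl 1)]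
          (X 1 ^ k - Polynomial.aeval (X 0 : MvPolynomial (Fin 2) ℂ) P) = 0 ∧
      w (Sum.inr 0) = MvPolynomial.eval ![w (Sum.inl 0), w (Sum.inl 1)]
        (X 0 : MvPolynomial (Fin 2) ℂ)} := by
  have hk1 : 1 ≤ k := by omega
  have hS := isIrreducibleClosed_curveGraphFibre (X 0 : MvPolynomial (Fin 2) ℂ)
    (irreducible_superellipticMv P hk1 hr hr1)
  have hdim := zariskiDim_curveGraphFibre (X 0 : MvPolynomial (Fin 2) ℂ)
    (irreducible_superellipticMv P hk1 hr hr1)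
  obtain ⟨ζ, z, hζ, hz, hre⟩ := exists_sheet_direction hk P.natDegree
  obtain ⟨Φ, hΦan, hΦ0, hsheet⟩ := superelliptic_sheet_facts P hk1 hP hζ
  have hgerm : ∀ᶠ s in 𝓝[≠] (0 : ℂ),
      (Sum.elim ![(s ^ k)⁻¹, Φ s * (s ^ P.natDegree)⁻¹]
          ![(fun _ : ℂ => (1 : ℂ)) s * s ^ (-(k : ℤ)), Complex.exp (Φ s * (s ^ P.natDegree)⁻¹)] :
            Fin 2 ⊕ Fin 2 → ℂ) ∈
        {w : Fin 2 ⊕ Fin 2 → ℂ |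
          MvPolynomial.eval ![w (Sum.inl 0), w (Sum.inl 1)]
              (X 1 ^ k - Polynomial.aeval (X 0 : MvPolynomial (Fin 2) ℂ) P) = 0 ∧
          w (Sum.inr 0) = MvPolynomial.eval ![w (Sum.inl 0), w (Sum.inl 1)]
            (X 0 : MvPolynomial (Fin 2) ℂ)} := by
    filter_upwards [hsheet] with s hs
    refine ⟨?_, ?_⟩
    · simp only [Sum.elim_inl, Matrix.cons_val_zero, Matrix.cons_val_one]
      rw [eval_superellipticMv]
      simpa only [Matrix.cons_val_zero, Matrix.cons_val_one] using hs
    · simp only [Sum.elim_inr, Sum.elim_inl, Matrix.cons_val_zero, MvPolynomial.eval_X, zpow_neg,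
        zpow_natCast, one_mul]
  exact unprojectedDense_branch_poleFibre_of_exists_direction hS (le_of_eq hdim) hk1 hM
    (-(k : ℤ)) analyticAt_const one_ne_zero hΦan ⟨z, hz, by rw [hΦ0]; exact hre⟩ hgerm

/-- **Mantova–Masser's question for the coordinate fibres over `x₁^k = P(x₀)`, `k ≥ 3`: case ∧
dense, both fibres, every degree** (`P` monic of degree `≥ 1` with a simple root), in plain
coordinates. [cite: MantovaMasser2023, §1 Further remarks, p. 5 (the question, open in general)]
(new) -/
theorem unprojectedDensityQuestion_superelliptic_coordFibres_all {k : ℕ} (hk : 3 ≤ k)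
    (hP : P.Monic) (hM : 1 ≤ P.natDegree) {r : ℂ} (hr : P.IsRoot r)
    (hr1 : P.derivative.eval r ≠ 0) :
    (MMCaseDimPiOneFree {w : Fin 2 ⊕ Fin 2 → ℂ |
        w (Sum.inl 1) ^ k - P.eval (w (Sum.inl 0)) = 0 ∧ w (Sum.inr 0) = w (Sum.inl 1)} ∧
      UnprojectedDense {w : Fin 2 ⊕ Fin 2 → ℂ |
        w (Sum.inl 1) ^ k - P.eval (w (Sum.inl 0)) = 0 ∧ w (Sum.inr 0) = w (Sum.inl 1)}) ∧
    (MMCaseDimPiOneFree {w : Fin 2 ⊕ Fin 2 → ℂ |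
        w (Sum.inl 1) ^ k - P.eval (w (Sum.inl 0)) = 0 ∧ w (Sum.inr 0) = w (Sum.inl 0)} ∧
      UnprojectedDense {w : Fin 2 ⊕ Fin 2 → ℂ |
        w (Sum.inl 1) ^ k - P.eval (w (Sum.inl 0)) = 0 ∧ w (Sum.inr 0) = w (Sum.inl 0)}) := by
  have hP0 : P ≠ 0 := by
    rintro rfl
    simp at hr1
  have e₁ : {w : Fin 2 ⊕ Fin 2 → ℂ |
        MvPolynomial.eval ![w (Sum.inl 0), w (Sum.inl 1)]
            (X 1 ^ k - Polynomial.aeval (X 0 : MvPolynomial (Fin 2) ℂ) P) = 0 ∧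
        w (Sum.inr 0) = MvPolynomial.eval ![w (Sum.inl 0), w (Sum.inl 1)]
          (X 1 : MvPolynomial (Fin 2) ℂ)} =
      {w : Fin 2 ⊕ Fin 2 → ℂ |
        w (Sum.inl 1) ^ k - P.eval (w (Sum.inl 0)) = 0 ∧ w (Sum.inr 0) = w (Sum.inl 1)} := by
    ext w
    simp only [Set.mem_setOf_eq, eval_superellipticMv, MvPolynomial.eval_X, Matrix.cons_val_zero,
      Matrix.cons_val_one]
  have e₀ : {w : Fin 2 ⊕ Fin 2 → ℂ |
        MvPolynomial.eval ![w (Sum.inl 0), w (Sum.inl 1)]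
            (X 1 ^ k - Polynomial.aeval (X 0 : MvPolynomial (Fin 2) ℂ) P) = 0 ∧
        w (Sum.inr 0) = MvPolynomial.eval ![w (Sum.inl 0), w (Sum.inl 1)]
          (X 0 : MvPolynomial (Fin 2) ℂ)} =
      {w : Fin 2 ⊕ Fin 2 → ℂ |
        w (Sum.inl 1) ^ k - P.eval (w (Sum.inl 0)) = 0 ∧ w (Sum.inr 0) = w (Sum.inl 0)} := by
    ext w
    simp only [Set.mem_setOf_eq, eval_superellipticMv, MvPolynomial.eval_X, Matrix.cons_val_zero,
      Matrix.cons_val_one]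
  have hcase₀ : MMCaseDimPiOneFree {w : Fin 2 ⊕ Fin 2 → ℂ |
      MvPolynomial.eval ![w (Sum.inl 0), w (Sum.inl 1)]
          (X 1 ^ k - Polynomial.aeval (X 0 : MvPolynomial (Fin 2) ℂ) P) = 0 ∧
      w (Sum.inr 0) = MvPolynomial.eval ![w (Sum.inl 0), w (Sum.inl 1)]
        (X 0 : MvPolynomial (Fin 2) ℂ)} := by
    refine mmCase_curveGraphFibre (irreducible_superellipticMv P (by omega) hr hr1) ?_
      (superelliptic_not_on_line P (by omega) hP0)
    obtain ⟨x, hx, hx0, -⟩ := superelliptic_exists_point_ne_zero P (k := k) (by omega) hP0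
    exact ⟨x, hx, by rw [MvPolynomial.eval_X]; exact hx0⟩
  have h₁ : MMCaseDimPiOneFree _ ∧ UnprojectedDense _ :=
    ⟨mmCase_superelliptic_fibre_x₁ P (k := k) (by omega) hr hr1,
      unprojectedDense_superelliptic_fibre_x₁_all P hk hP hM hr hr1⟩
  have h₀ : MMCaseDimPiOneFree _ ∧ UnprojectedDense _ :=
    ⟨hcase₀, unprojectedDense_superelliptic_fibre_x₀_all P hk hP hM hr hr1⟩
  rw [e₁] at h₁
  rw [e₀] at h₀
  exact ⟨h₁, h₀⟩

end Superelliptic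

/-! ## Part D. The `(3,3)`-type example -/

/-- **`{x₁³ = x₀³ + 1, y₀ = θ}` is in Mantova–Masser's case AND dense for every `θ ≠ 0`** — the
`(k, M) = (3, 3)` curve (three asymptotes `x₁ = ζx₀`, `ζ³ = 1`; on the sheets `ζ ≠ 1` the direction
is non-real).  Together with **`{x₁³ = x₀³ + 1, y₀ = x₁}`**.
[cite: MantovaMasser2023, §1 Further remarks, p. 5 (the question, open in general)] (new) -/
theorem unprojectedDensityQuestion_cubicFermatType {θ : ℂ} (hθ : θ ≠ 0) :
    (MMCaseDimPiOneFree {w : Fin 2 ⊕ Fin 2 → ℂ |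
        w (Sum.inl 1) ^ 3 - (Polynomial.X ^ 3 + 1 : Polynomial ℂ).eval (w (Sum.inl 0)) = 0 ∧
          w (Sum.inr 0) = θ} ∧
      UnprojectedDense {w : Fin 2 ⊕ Fin 2 → ℂ |
        w (Sum.inl 1) ^ 3 - (Polynomial.X ^ 3 + 1 : Polynomial ℂ).eval (w (Sum.inl 0)) = 0 ∧
          w (Sum.inr 0) = θ}) ∧
    (MMCaseDimPiOneFree {w : Fin 2 ⊕ Fin 2 → ℂ |
        w (Sum.inl 1) ^ 3 - (Polynomial.X ^ 3 + 1 : Polynomial ℂ).eval (w (Sum.inl 0)) = 0 ∧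
          w (Sum.inr 0) = w (Sum.inl 1)} ∧
      UnprojectedDense {w : Fin 2 ⊕ Fin 2 → ℂ |
        w (Sum.inl 1) ^ 3 - (Polynomial.X ^ 3 + 1 : Polynomial ℂ).eval (w (Sum.inl 0)) = 0 ∧
          w (Sum.inr 0) = w (Sum.inl 1)}) := by
  have hmonic : (Polynomial.X ^ 3 + 1 : Polynomial ℂ).Monic := by
    simpa using Polynomial.monic_X_pow_add_C (1 : ℂ) (by norm_num : (3 : ℕ) ≠ 0)
  have hdeg : (Polynomial.X ^ 3 + 1 : Polynomial ℂ).natDegree = 3 := by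
    simpa using Polynomial.natDegree_X_pow_add_C (n := 3) (r := (1 : ℂ))
  obtain ⟨ρ, hρ⟩ := IsAlgClosed.exists_pow_nat_eq (-1 : ℂ) (by norm_num : 0 < 3)
  have hρ0 : ρ ≠ 0 := by
    rintro rfl
    norm_num at hρ
  have hroot : (Polynomial.X ^ 3 + 1 : Polynomial ℂ).IsRoot ρ := by
    simp [Polynomial.IsRoot, hρ]
  have hder : (Polynomial.derivative (Polynomial.X ^ 3 + 1 : Polynomial ℂ)).eval ρ ≠ 0 := by
    rw [Polynomial.derivative_add, Polynomial.derivative_one, Polynomial.derivative_X_pow, add_zero,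
      Polynomial.eval_mul, Polynomial.eval_C, Polynomial.eval_pow, Polynomial.eval_X]
    exact mul_ne_zero (by norm_num) (pow_ne_zero _ hρ0)
  exact ⟨unprojectedDensityQuestion_superelliptic_constFibre_all _ le_rfl hmonic (by omega) hroot hder
    hθ, (unprojectedDensityQuestion_superelliptic_coordFibres_all _ le_rfl hmonic (by omega) hroot
      hder).1⟩

end Summit.Schanuel.Schanuel.Theorems

end
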